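import Literature.Analysis.UnboundedOperators.HeatKernelReversePoincare
import Mathlib.MeasureTheory.Function.L2Space
import HarnessLib

/-!
# The caloric Bernstein estimate for vector fields and the variance identity of the heat kernel

Analysis/UnboundedOperators file (all results proved, no definitions, no named facts), the
vector-valued companion of `HeatKernelReversePoincare.lean`. For a finite-dimensional real inner
product space `E`, the Gauss–Weierstrass kernel `G_t = heatKernel t` (`0 < t`), a real Hilbert
space `F` and a bounded continuous `u : E → F`:

* `sq_norm_heatExtension_add_integral_eq` — the **variance identity**
  `‖V‖² + ∫ G_t(z)‖u(x − z) − V‖² dz = e^{tΔ}(‖u‖²)(x)`, `V = (e^{tΔ}u)(x)`: near-extremality of the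
  caloric field at `(t, x)` (`‖V‖ ≥ sup‖u‖ − η`) makes the datum mean-square constant around `x`
  in the Gaussian weight `G_t(x − ·)`;
* `sq_norm_heatExtension_add_sum_le` (`F` finite-dimensional) — the **caloric Bernstein
  estimate** `‖(e^{tΔ}u)(x)‖² + 2t ‖∇(e^{tΔ}u)(x)‖_F² ≤ e^{tΔ}(‖u‖²)(x)` (Frobenius norm written as
  the sum over an orthonormal basis of `E`; the scalar reverse Poincaré inequality of
  Bakry–Gentil–Ledoux, Thm. 4.7.2, applied to the components `⟪u, eⱼ⟫` and summed), and its sup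
  form `two_mul_mul_sum_sq_norm_fderiv_heatExtension_le`: `2t‖∇e^{tΔ}u(x)‖_F² ≤ B₀² − ‖e^{tΔ}u(x)‖²`
  for `‖u‖ ≤ B₀` — the full gradient of the free evolution of a bounded velocity field is small
  wherever its speed is close to the initial maximum (level sets of the speed near the maximum,
  `Summits/NavierStokesRegularity`, route `LevelSetModeration`).

## References

* D. Bakry, I. Gentil, M. Ledoux, *Analysis and Geometry of Markov Diffusion Operators*,
  Springer 2014, Thm. 4.7.2. [cite: BakryGentilLedoux2014, Thm. 4.7.2]
-/

open MeasureTheory Filter Topology Set InnerProductSpace Metric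
open scoped Real RealInnerProductSpace

noncomputable section

namespace Literature.Analysis.UnboundedOperators

variable {E : Type*} [NormedAddCommGroup E] [InnerProductSpace ℝ E] [FiniteDimensional ℝ E]
  [MeasurableSpace E] [BorelSpace E]

/-! ### Vector-valued data: the variance identity and the caloric Bernstein estimate -/

section Vector

variable {F : Type*} [NormedAddCommGroup F] [InnerProductSpace ℝ F] [CompleteSpace F]

/-- **Variance identity of the heat kernel measure** (vector-valued data). For a bounded
continuous `u : E → F` with values in a real Hilbert space, `0 < t`, `x ∈ E` and
`V = (e^{tΔ}u)(x)`: `‖V‖² + ∫ G_t(z) ‖u(x − z) − V‖² dz = e^{tΔ}(‖u‖²)(x)` — the mean square of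
`u` under the probability density `G_t(x − ·)` splits into the square of the mean and the
variance. In particular `‖(e^{tΔ}u)(x)‖ ≥ sup‖u‖ − η` forces `u` to be mean-square close to the
constant vector `V` around `x` (the datum of a caloric field is nearly constant, in Gaussian mean
square, below every point where the field is nearly extremal). [folklore] -/
theorem sq_norm_heatExtension_add_integral_eq {u : E → F} (hu : Continuous u) {C : ℝ}
    (hC : ∀ z, ‖u z‖ ≤ C) {t : ℝ} (ht : 0 < t) (x : E) :
    ‖heatExtension u t x‖ ^ 2 +
        ∫ z, heatKernel t z * ‖u (x - z) - heatExtension u t x‖ ^ 2 =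
      heatExtension (fun y => ‖u y‖ ^ 2) t x := by
  have hK := integrable_heatKernel_holds (E := E) ht
  have hK1 := integral_heatKernel_eq_one_holds (E := E) ht
  have huc : Continuous fun z => u (x - z) := hu.comp (continuous_const.sub continuous_id)
  have hub : ∀ z, ‖u (x - z)‖ ≤ C := fun z => hC _
  set V : F := heatExtension u t x with hVdef
  have hV : V = ∫ z, heatKernel t z • u (x - z) := by rw [hVdef, heatExtension_apply]
  have hS : heatExtension (fun y => ‖u y‖ ^ 2) t x = ∫ z, heatKernel t z * ‖u (x - z)‖ ^ 2 := by
    rw [heatExtension_apply]; rfl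
  -- integrable pieces
  have iGu : Integrable fun z => heatKernel t z • u (x - z) :=
    integrable_heatKernel_smul_of_bound hu hC ht x
  have h2c : Continuous fun z => ‖u (x - z)‖ ^ 2 := (huc.norm).pow 2
  have h2b : ∀ z, ‖‖u (x - z)‖ ^ 2‖ ≤ C ^ 2 := fun z => by
    rw [norm_pow, norm_norm]; exact pow_le_pow_left₀ (norm_nonneg _) (hub z) 2
  have iGu2 : Integrable fun z => heatKernel t z * ‖u (x - z)‖ ^ 2 :=
    (hK.bdd_mul h2c.aestronglyMeasurable (Eventually.of_forall h2b)).congr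
      (Eventually.of_forall fun z => mul_comm _ _)
  have hic : Continuous fun z => ⟪u (x - z), V⟫ := huc.inner continuous_const
  have hib : ∀ z, ‖⟪u (x - z), V⟫‖ ≤ C * ‖V‖ := fun z =>
    (norm_inner_le_norm _ _).trans (mul_le_mul_of_nonneg_right (hub z) (norm_nonneg _))
  have iGi : Integrable fun z => heatKernel t z * ⟪u (x - z), V⟫ :=
    (hK.bdd_mul hic.aestronglyMeasurable (Eventually.of_forall hib)).congr
      (Eventually.of_forall fun z => mul_comm _ _)
  -- `∫ G ⟪u(x-z), V⟫ = ⟪V, V⟫`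
  have hcross : ∫ z, heatKernel t z * ⟪u (x - z), V⟫ = ‖V‖ ^ 2 := by
    have h1 : (fun z => heatKernel t z * ⟪u (x - z), V⟫) =
        fun z => ⟪V, heatKernel t z • u (x - z)⟫ := funext fun z => by
      rw [real_inner_smul_right, real_inner_comm]
    rw [h1, integral_inner iGu V, ← hV, real_inner_self_eq_norm_sq]
  -- expand `‖a - V‖² = ‖a‖² - 2⟪a, V⟫ + ‖V‖²`
  have hexp : ∀ z, heatKernel t z * ‖u (x - z) - V‖ ^ 2 =
      heatKernel t z * ‖u (x - z)‖ ^ 2 - 2 * (heatKernel t z * ⟪u (x - z), V⟫)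
        + ‖V‖ ^ 2 * heatKernel t z := fun z => by
    rw [@norm_sub_sq ℝ, real_inner_comm]
    simp only [RCLike.re_to_real]
    ring
  have i12 : Integrable fun z =>
      heatKernel t z * ‖u (x - z)‖ ^ 2 - 2 * (heatKernel t z * ⟪u (x - z), V⟫) :=
    iGu2.sub (iGi.const_mul _)
  rw [integral_congr_ae (Eventually.of_forall hexp), integral_add i12 (hK.const_mul _),
    integral_sub iGu2 (iGi.const_mul _), integral_const_mul, integral_const_mul, hcross, hK1, ← hS]
  ring

variable [FiniteDimensional ℝ F]

omit [MeasurableSpace E] [BorelSpace E] [CompleteSpace F] in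
/-- The square of the operator norm of a real linear functional on a finite-dimensional inner
product space is the sum of the squares of its values on an orthonormal basis (Riesz
representation and Parseval). [folklore] -/
theorem sq_norm_dual_eq_sum_sq {ι : Type*} [Fintype ι] (b : OrthonormalBasis ι ℝ E)
    (φ : E →L[ℝ] ℝ) : ‖φ‖ ^ 2 = ∑ i, φ (b i) ^ 2 := by
  haveI : CompleteSpace E := FiniteDimensional.complete ℝ E
  set g : E := (InnerProductSpace.toDual ℝ E).symm φ with hg
  have hφ : ∀ y, φ y = ⟪g, y⟫ := fun y => by
    rw [hg, InnerProductSpace.toDual_symm_apply]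
  have hn : ‖φ‖ = ‖g‖ := by rw [hg, LinearIsometryEquiv.norm_map]
  rw [hn, ← real_inner_self_eq_norm_sq, ← b.sum_inner_mul_inner g g]
  refine Finset.sum_congr rfl fun i _ => ?_
  rw [hφ, real_inner_comm (b i) g, pow_two]

/-- **Caloric Bernstein estimate for vector fields.** For a bounded continuous `u : E → F`
(`F` a finite-dimensional real inner product space, e.g. velocity fields `ℝ³ → ℝ³`), `0 < t`,
`x ∈ E` and any orthonormal basis `b` of `E`:
`‖(e^{tΔ}u)(x)‖² + 2t ∑ᵢ ‖∂_{bᵢ}(e^{tΔ}u)(x)‖² ≤ e^{tΔ}(‖u‖²)(x)` (the reverse Poincaré inequality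
`sq_heatExtension_add_le_heatExtension_sq` applied to the components `⟪u, eⱼ⟫` and summed over an
orthonormal basis `(eⱼ)` of `F`; the middle term is `2t` times the squared Frobenius norm of
`∇(e^{tΔ}u)(x)`). With `‖u‖ ≤ B₀`: `2t ‖∇e^{tΔ}u(x)‖_F² ≤ B₀² − ‖e^{tΔ}u(x)‖²`, so the full
velocity gradient of the free evolution is small wherever the speed is close to its initial
maximum. [cite: BakryGentilLedoux2014, Thm. 4.7.2] -/
theorem sq_norm_heatExtension_add_sum_le {u : E → F} (hu : Continuous u) {C : ℝ}
    (hC : ∀ z, ‖u z‖ ≤ C) {t : ℝ} (ht : 0 < t) (x : E) {ι : Type*} [Fintype ι]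
    (b : OrthonormalBasis ι ℝ E) :
    ‖heatExtension u t x‖ ^ 2 +
        2 * t * ∑ i, ‖fderiv ℝ (heatExtension u t) x (b i)‖ ^ 2 ≤
      heatExtension (fun y => ‖u y‖ ^ 2) t x := by
  have hK := integrable_heatKernel_holds (E := E) ht
  have huc : Continuous fun z => u (x - z) := hu.comp (continuous_const.sub continuous_id)
  have hub : ∀ z, ‖u (x - z)‖ ≤ C := fun z => hC _
  set e := stdOrthonormalBasis ℝ F with he
  -- the components `f j = ⟪u, e j⟫`
  set f : Fin (Module.finrank ℝ F) → E → ℝ := fun j y => ⟪u y, e j⟫ with hf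
  have hfc : ∀ j, Continuous (f j) := fun j => hu.inner continuous_const
  have hfb : ∀ j z, ‖f j z‖ ≤ C := fun j z =>
    (norm_inner_le_norm _ _).trans (by rw [e.orthonormal.1 j, mul_one]; exact hC z)
  -- the caloric extension of a component is the component of the caloric extension
  have hext : ∀ j y, heatExtension (f j) t y = ⟪heatExtension u t y, e j⟫ := fun j y => by
    rw [heatExtension_apply, heatExtension_apply, real_inner_comm,
      ← integral_inner (integrable_heatKernel_smul_of_bound hu hC ht y) (e j)]
    refine integral_congr_ae (Eventually.of_forall fun z => ?_)
    simp only [hf, smul_eq_mul, real_inner_smul_right]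
    congr 1
    exact real_inner_comm _ _
  have hextf : ∀ j, heatExtension (f j) t = fun y => ⟪heatExtension u t y, e j⟫ :=
    fun j => funext (hext j)
  -- its derivative
  have hmem : MemLp u ⊤ volume := memLp_top_of_continuous_of_bound hu hC
  have hDu := hasFDerivAt_heatExtension (F := F) hmem le_top ht x
  set L : E →L[ℝ] F := fderiv ℝ (heatExtension u t) x with hL
  have hD : ∀ j, fderiv ℝ (heatExtension (f j) t) x = (innerSL ℝ (e j)).comp L := fun j => by
    rw [hextf j]
    have h1 : (fun y => ⟪heatExtension u t y, e j⟫) =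
        fun y => innerSL ℝ (e j) (heatExtension u t y) :=
      funext fun y => by rw [innerSL_apply_apply, real_inner_comm]
    rw [h1, hL]
    exact ((innerSL ℝ (e j)).hasFDerivAt.comp x hDu.differentiableAt.hasFDerivAt).fderiv
  -- the scalar inequality for each component, summed
  have hcomp : ∀ j, ⟪heatExtension u t x, e j⟫ ^ 2 +
      2 * t * ∑ i, ⟪L (b i), e j⟫ ^ 2 ≤ heatExtension (fun y => f j y ^ 2) t x := fun j => by
    have h := sq_heatExtension_add_le_heatExtension_sq (hfc j) (hfb j) ht x
    rw [hext j, hD j, sq_norm_dual_eq_sum_sq b] at h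
    have h2 : ∀ i, ((innerSL ℝ (e j)).comp L) (b i) = ⟪L (b i), e j⟫ := fun i => by
      rw [ContinuousLinearMap.comp_apply, innerSL_apply_apply, real_inner_comm]
    simp only [h2] at h
    exact h
  have hsum := Finset.sum_le_sum fun j (_ : j ∈ Finset.univ) => hcomp j
  -- identify the three sums
  have h1 : ∑ j, ⟪heatExtension u t x, e j⟫ ^ 2 = ‖heatExtension u t x‖ ^ 2 := by
    rw [← real_inner_self_eq_norm_sq, ← e.sum_inner_mul_inner]
    refine Finset.sum_congr rfl fun j _ => ?_
    rw [pow_two, real_inner_comm (e j)]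
  have h2 : ∑ j, ∑ i, ⟪L (b i), e j⟫ ^ 2 = ∑ i, ‖L (b i)‖ ^ 2 := by
    rw [Finset.sum_comm]
    refine Finset.sum_congr rfl fun i _ => ?_
    rw [← real_inner_self_eq_norm_sq, ← e.sum_inner_mul_inner]
    refine Finset.sum_congr rfl fun j _ => ?_
    rw [pow_two, real_inner_comm (e j)]
  have h3 : ∑ j, heatExtension (fun y => f j y ^ 2) t x =
      heatExtension (fun y => ‖u y‖ ^ 2) t x := by
    have hj : ∀ j, heatExtension (fun y => f j y ^ 2) t x =
        ∫ z, heatKernel t z * f j (x - z) ^ 2 :=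
      fun j => by rw [heatExtension_apply]; rfl
    have hS : heatExtension (fun y => ‖u y‖ ^ 2) t x = ∫ z, heatKernel t z * ‖u (x - z)‖ ^ 2 := by
      rw [heatExtension_apply]; rfl
    have hi : ∀ j ∈ Finset.univ, Integrable fun z => heatKernel t z * f j (x - z) ^ 2 :=
      fun j _ => by
      have hc2 : Continuous fun z => f j (x - z) ^ 2 :=
        ((hfc j).comp (continuous_const.sub continuous_id)).pow 2
      have hb2 : ∀ z, ‖f j (x - z) ^ 2‖ ≤ C ^ 2 := fun z => by
        rw [norm_pow]; exact pow_le_pow_left₀ (norm_nonneg _) (hfb j _) 2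
      exact (hK.bdd_mul hc2.aestronglyMeasurable (Eventually.of_forall hb2)).congr
        (Eventually.of_forall fun z => mul_comm _ _)
    simp only [hj]
    rw [← integral_finsetSum _ hi, hS]
    refine integral_congr_ae (Eventually.of_forall fun z => ?_)
    dsimp only
    rw [← Finset.mul_sum, ← real_inner_self_eq_norm_sq, ← e.sum_inner_mul_inner]
    congr 1
    refine Finset.sum_congr rfl fun j _ => ?_
    simp only [hf]
    rw [pow_two, real_inner_comm (e j)]
  calc ‖heatExtension u t x‖ ^ 2 + 2 * t * ∑ i, ‖fderiv ℝ (heatExtension u t) x (b i)‖ ^ 2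
      = ∑ j, (⟪heatExtension u t x, e j⟫ ^ 2 + 2 * t * ∑ i, ⟪L (b i), e j⟫ ^ 2) := by
        rw [Finset.sum_add_distrib, h1, ← Finset.mul_sum, h2]
    _ ≤ ∑ j, heatExtension (fun y => f j y ^ 2) t x := hsum
    _ = heatExtension (fun y => ‖u y‖ ^ 2) t x := h3

/-- **Caloric Bernstein estimate for vector fields, sup form.** If `‖u‖ ≤ B₀` then
`2t ∑ᵢ ‖∂_{bᵢ}(e^{tΔ}u)(x)‖² ≤ B₀² − ‖(e^{tΔ}u)(x)‖²`: on the set where the free evolution of a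
bounded velocity field has speed at least `B₀ − η`, its full gradient is at most `√(B₀η/t)` in
Frobenius norm. [cite: BakryGentilLedoux2014, Thm. 4.7.2] -/
theorem two_mul_mul_sum_sq_norm_fderiv_heatExtension_le {u : E → F} (hu : Continuous u)
    {B₀ : ℝ} (hB : ∀ z, ‖u z‖ ≤ B₀) {t : ℝ} (ht : 0 < t) (x : E) {ι : Type*} [Fintype ι]
    (b : OrthonormalBasis ι ℝ E) :
    2 * t * ∑ i, ‖fderiv ℝ (heatExtension u t) x (b i)‖ ^ 2 ≤
      B₀ ^ 2 - ‖heatExtension u t x‖ ^ 2 := by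
  have h := sq_norm_heatExtension_add_sum_le hu hB ht x b
  have hK := integrable_heatKernel_holds (E := E) ht
  have huc : Continuous fun z => ‖u (x - z)‖ ^ 2 :=
    ((hu.comp (continuous_const.sub continuous_id)).norm).pow 2
  have hub : ∀ z, ‖‖u (x - z)‖ ^ 2‖ ≤ B₀ ^ 2 := fun z => by
    rw [norm_pow, norm_norm]; exact pow_le_pow_left₀ (norm_nonneg _) (hB _) 2
  have hi : Integrable fun z => heatKernel t z * ‖u (x - z)‖ ^ 2 :=
    (hK.bdd_mul huc.aestronglyMeasurable (Eventually.of_forall hub)).congr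
      (Eventually.of_forall fun z => mul_comm _ _)
  have hle : ∀ z, heatKernel t z * ‖u (x - z)‖ ^ 2 ≤ B₀ ^ 2 * heatKernel t z := fun z => by
    rw [mul_comm]
    exact mul_le_mul_of_nonneg_right (pow_le_pow_left₀ (norm_nonneg _) (hB _) 2)
      (heatKernel_pos ht z).le
  have hS : heatExtension (fun y => ‖u y‖ ^ 2) t x ≤ B₀ ^ 2 := by
    have hS' : heatExtension (fun y => ‖u y‖ ^ 2) t x =
        ∫ z, heatKernel t z * ‖u (x - z)‖ ^ 2 := by
      rw [heatExtension_apply]; rfl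
    rw [hS']
    calc ∫ z, heatKernel t z * ‖u (x - z)‖ ^ 2 ≤ ∫ z, B₀ ^ 2 * heatKernel t z :=
          integral_mono hi (hK.const_mul _) hle
      _ = B₀ ^ 2 := by rw [integral_const_mul, integral_heatKernel_eq_one_holds ht, mul_one]
  linarith

end Vector

end Literature.Analysis.UnboundedOperators

end
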